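import Summits.Ventures.PercRepro.Night2GoodTwoGoodTargets

/-!
# night-2: every target loaded by `dshGT2` has at most one coloop off `K`

A lossy big set `Q` without good point still has a distance-2 pair: each of its three thin faces misses a second
point of `G` besides its coloop, and two such points for two different faces are distinct (a common one would be a
good point).  A distance-2 target `insert p₁ (insert p₂ Q)` restores the two coloops whose hyperplanes miss `p₁`,
`p₂`, keeping at most the third; a good target keeps at most one (`card_coloops_le_one_of_mem_gtTargets`); and the
third tier of `dshGT2` never fires on a lossy big pair.  Hence `dshGT2 B z S ≠ 0` forces `|coloops (S ∖ K)| ≤ 1`,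
and the `dshGT2` load vanishes at every target with two or more coloops off `K` — the column bound there is trivial.
-/

namespace PercRepro.Shadow

open PercRepro.ThmH PercRepro.PerFlat

variable {α : Type*} [DecidableEq α] {M : Matroid α} [M.Finite] {G : Finset α}

/-- A thin face of `Q` is a thin member. -/
theorem mem_thinMembers_of_mem_thinFacesOf {q : ℕ} {Q F : Finset α} (hF : F ∈ thinFacesOf M q G Q) :
    F ∈ thinMembers M q G := by
  unfold thinFacesOf at hF
  rw [Finset.mem_filter, mem_coverPreimages] at hF
  exact mem_thinMembers.2 ⟨hF.1.1, hF.2⟩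

/-- **A lossy big set without good point has a distance-2 pair.** -/
theorem d2Targets_nonempty_of_not_gtPts (hG : G ∈ flatsQ M (5 + 1)) (hd : (gr M \ G).card = 2)
    (hk : kColoops M G = 1) (hs : ∀ e ∈ gr M, ∀ f ∈ gr M, e ≠ f → rkN M {e, f} = 2)
    (hl : ∀ e ∈ gr M, M.Indep {e}) {B : Finset α} (hB : B ∈ thinMembers M 5 G)
    (hbig : 5 ≤ (B \ coloops M G).card) {z : α} (hz : z ∈ G \ clF M B) (h : loss M 5 G B z ≠ 0)
    (hno : ¬ (gtPts M 5 G (insert z B)).Nonempty) : (d2Targets M 5 G (insert z B)).Nonempty := by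
  have hd' : (gr M \ G).card ≤ 5 := by omega
  have hGg : G ⊆ gr M := (mem_flatsQ.1 hG).1
  have hQG : insert z B ⊆ G :=
    Finset.insert_subset (Finset.mem_sdiff.1 hz).1 (subset_G_of_mem_thinMembers hB)
  have hfaces := thinFacesOf_eq_image_erase hG hd hk hs hl hB hbig hz h
  have h3 := card_coloops_eq_three_of_loss_ne_zero hG hd hk hs hl hB hbig hz h
  obtain ⟨wa, wb, wc, hab, hac, hbc, hcol⟩ := Finset.card_eq_three.1 h3
  have hwa : wa ∈ coloops M (insert z B \ coloops M G) := by rw [hcol]; simp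
  have hwb : wb ∈ coloops M (insert z B \ coloops M G) := by rw [hcol]; simp
  have hFa : (insert z B).erase wa ∈ thinFacesOf M 5 G (insert z B) := by
    rw [hfaces]; exact Finset.mem_image_of_mem _ hwa
  have hFb : (insert z B).erase wb ∈ thinFacesOf M 5 G (insert z B) := by
    rw [hfaces]; exact Finset.mem_image_of_mem _ hwb
  -- a second point of `G` off each thin hyperplane, outside `Q`
  have hpt : ∀ w ∈ coloops M (insert z B \ coloops M G),
      ∃ x ∈ G \ insert z B, x ∉ clF M ((insert z B).erase w) := by
    intro w hw
    have hF : (insert z B).erase w ∈ thinFacesOf M 5 G (insert z B) := by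
      rw [hfaces]; exact Finset.mem_image_of_mem _ hw
    have hthin := mem_thinMembers_of_mem_thinFacesOf hF
    have hm := two_le_card_sdiff_of_not_lay0 hG hd' (mem_thinMembers.1 hthin).1 (mem_thinMembers.1 hthin).2
    obtain ⟨x, hx, hxw⟩ := Finset.exists_mem_ne (s := G \ clF M ((insert z B).erase w)) (by omega) w
    rw [Finset.mem_sdiff] at hx
    refine ⟨x, Finset.mem_sdiff.2 ⟨hx.1, fun hxQ => hx.2 ?_⟩, hx.2⟩
    exact subset_clF_of_subset_gr ((Finset.erase_subset _ _).trans (hQG.trans hGg))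
      (Finset.mem_erase.2 ⟨hxw, hxQ⟩)
  obtain ⟨x, hxGQ, hxa⟩ := hpt wa hwa
  obtain ⟨x', hx'GQ, hx'b⟩ := hpt wb hwb
  -- the two points differ: a common one would be a good point
  have hne : x ≠ x' := by
    rintro rfl
    apply hno
    refine ⟨x, ?_⟩
    simp only [gtPts, Finset.mem_filter]
    refine ⟨hxGQ, ?_⟩
    have hsub : (thinFacesOf M 5 G (insert z B)).filter (fun F => x ∈ clF M F) ⊆
        {(insert z B).erase wc} := by
      intro F hF
      rw [Finset.mem_filter, hfaces, Finset.mem_image] at hF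
      obtain ⟨⟨w, hw, rfl⟩, hxF⟩ := hF
      rw [hcol, Finset.mem_insert, Finset.mem_insert, Finset.mem_singleton] at hw
      rw [Finset.mem_singleton]
      rcases hw with rfl | rfl | rfl
      · exact absurd hxF hxa
      · exact absurd hxF hx'b
      · rfl
    exact (Finset.card_le_card hsub).trans (by rw [Finset.card_singleton])
  have hFab : (insert z B).erase wa ≠ (insert z B).erase wb := by
    intro heq
    have hmem : wb ∈ (insert z B).erase wa :=
      Finset.mem_erase.2 ⟨hab.symm, (Finset.mem_sdiff.1 (mem_coloops.1 hwb).1).1⟩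
    rw [heq] at hmem
    exact (Finset.mem_erase.1 hmem).1 rfl
  exact ⟨insert x (insert x' (insert z B)), mem_d2Targets.2 ⟨(x, x'),
    mem_d2Pts.2 ⟨⟨hxGQ, hx'GQ⟩, hne, (insert z B).erase wa, hFa, (insert z B).erase wb, hFb, hFab, hxa, hx'b⟩,
    rfl⟩⟩

/-- **A distance-2 target of a lossy big pair has at most one coloop off `K`.** -/
theorem card_coloops_le_one_of_mem_d2Targets (hG : G ∈ flatsQ M (5 + 1)) (hd : (gr M \ G).card = 2)
    (hk : kColoops M G = 1) (hs : ∀ e ∈ gr M, ∀ f ∈ gr M, e ≠ f → rkN M {e, f} = 2)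
    (hl : ∀ e ∈ gr M, M.Indep {e}) {B : Finset α} (hB : B ∈ thinMembers M 5 G)
    (hbig : 5 ≤ (B \ coloops M G).card) {z : α} (hz : z ∈ G \ clF M B) (h : loss M 5 G B z ≠ 0)
    {T : Finset α} (hT : T ∈ d2Targets M 5 G (insert z B)) : (coloops M (T \ coloops M G)).card ≤ 1 := by
  have hd' : (gr M \ G).card ≤ 5 := by omega
  have hGg : G ⊆ gr M := (mem_flatsQ.1 hG).1
  have hKB : coloops M G ⊆ B := coloops_subset_of_mem_thinMembers hG hd' hB
  have hBG : B ⊆ G := subset_G_of_mem_thinMembers hB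
  have hzG : z ∈ G := (Finset.mem_sdiff.1 hz).1
  have hzcl : z ∉ clF M B := (Finset.mem_sdiff.1 hz).2
  have hQG : insert z B ⊆ G := Finset.insert_subset hzG hBG
  have hKQ : coloops M G ⊆ insert z B := hKB.trans (Finset.subset_insert _ _)
  have hKG : coloops M G ⊆ G := fun e he => (mem_coloops.1 he).1
  have hrQ : rkN M (insert z B) = 6 := by
    rw [rkN_insert_of_notMem_clF (hGg hzG) hzcl, rkN_eq_five_of_mem_thinMembers hB]
  have hrQs : rkN M (insert z B \ coloops M G) = 5 := by
    have := rkN_eq_rkN_sdiff_add_one hG hk (S := insert z B) hQG (Finset.Subset.refl _) hKQ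
    omega
  have hrGs : rkN M (G \ coloops M G) = 5 := by
    have := rkN_eq_rkN_sdiff_add_one hG hk (S := G) (Finset.Subset.refl _) (Finset.Subset.refl _) hKG
    rw [rkN_eq_of_mem_flatsQ hG] at this
    omega
  have hfaces := thinFacesOf_eq_image_erase hG hd hk hs hl hB hbig hz h
  have h3 := card_coloops_eq_three_of_loss_ne_zero hG hd hk hs hl hB hbig hz h
  obtain ⟨p, hp, rfl⟩ := mem_d2Targets.1 hT
  obtain ⟨⟨hp1, hp2⟩, hne, F, hF, F', hF', hFF', hp1F, hp2F'⟩ := mem_d2Pts.1 hp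
  rw [hfaces, Finset.mem_image] at hF hF'
  obtain ⟨w, hw, rfl⟩ := hF
  obtain ⟨w', hw', rfl⟩ := hF'
  have hww' : w ≠ w' := by
    rintro rfl
    exact hFF' rfl
  rw [Finset.mem_sdiff] at hp1 hp2
  have hp1K : p.1 ∉ coloops M G := fun hk' => hp1.2 (hKQ hk')
  have hp2K : p.2 ∉ coloops M G := fun hk' => hp2.2 (hKQ hk')
  have hTG : insert p.1 (insert p.2 (insert z B)) ⊆ G :=
    Finset.insert_subset hp1.1 (Finset.insert_subset hp2.1 hQG)
  have hTeq : insert p.1 (insert p.2 (insert z B)) \ coloops M G =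
      insert p.1 (insert p.2 (insert z B \ coloops M G)) := by
    rw [Finset.insert_sdiff_of_notMem _ hp1K, Finset.insert_sdiff_of_notMem _ hp2K]
  -- every point of `G ∖ K` lies in `clF (Q ∖ K)`
  have hclQ : ∀ y ∈ G, y ∉ coloops M G → y ∈ clF M (insert z B \ coloops M G) := by
    intro y hyG hyK
    have hsubG : insert y (insert z B \ coloops M G) ⊆ G \ coloops M G :=
      Finset.insert_subset (Finset.mem_sdiff.2 ⟨hyG, hyK⟩)
        (Finset.sdiff_subset_sdiff hQG (Finset.Subset.refl _))
    have h1 := rkN_mono (M := M) hsubG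
    have h2 := rkN_mono (M := M) (Finset.subset_insert y (insert z B \ coloops M G))
    rw [hrGs] at h1
    rw [hrQs] at h2
    exact mem_clF_of_rkN_eq (Finset.subset_insert _ _) (hsubG.trans (Finset.sdiff_subset.trans hGg))
      (by rw [hrQs]; omega) (Finset.mem_insert_self _ _)
  -- a coloop `w` of `Q ∖ K` whose hyperplane misses a point `x` of the target is restored
  have hrest : ∀ w ∈ coloops M (insert z B \ coloops M G), ∀ x ∈ insert p.1 (insert p.2 (insert z B)),
      x ∉ insert z B → x ∉ clF M ((insert z B).erase w) →
      w ∉ coloops M (insert p.1 (insert p.2 (insert z B)) \ coloops M G) := by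
    intro w hw x hxT hxQ hxn hwT
    have hF : (insert z B).erase w ∈ thinFacesOf M 5 G (insert z B) := by
      rw [hfaces]; exact Finset.mem_image_of_mem _ hw
    have r5 := rkN_eq_five_of_mem_thinMembers (mem_thinMembers_of_mem_thinFacesOf hF)
    have r6 := rkN_insert_of_notMem_clF (hGg (hTG hxT)) hxn
    have hwQ : w ∈ insert z B := (Finset.mem_sdiff.1 (mem_coloops.1 hw).1).1
    have hwx : w ≠ x := fun h' => hxQ (h' ▸ hwQ)
    have hsub : insert x ((insert z B).erase w) ⊆ (insert p.1 (insert p.2 (insert z B))).erase w := by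
      intro y hy
      rw [Finset.mem_insert] at hy
      rcases hy with rfl | hy
      · exact Finset.mem_erase.2 ⟨hwx.symm, hxT⟩
      · exact Finset.mem_erase.2 ⟨(Finset.mem_erase.1 hy).1,
          Finset.mem_insert_of_mem (Finset.mem_insert_of_mem (Finset.mem_erase.1 hy).2)⟩
    have h1 := rkN_mono (M := M) hsub
    have h2 := rkN_mono (M := M) hTG
    have h3' := rkN_mono (M := M) (Finset.erase_subset w (insert p.1 (insert p.2 (insert z B))))
    rw [rkN_eq_of_mem_flatsQ hG] at h2
    rw [r6, r5] at h1
    have hwT' : w ∈ insert p.1 (insert p.2 (insert z B)) :=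
      Finset.mem_insert_of_mem (Finset.mem_insert_of_mem hwQ)
    have hwcl : w ∈ clF M ((insert p.1 (insert p.2 (insert z B))).erase w) :=
      mem_clF_of_rkN_eq (Finset.erase_subset _ _) (hTG.trans hGg) (by omega) hwT'
    exact (mem_coloops.1 (mem_coloops_of_mem_coloops_sdiff hG hk hTG hwT)).2 hwcl
  -- the coloops of `T ∖ K` lie among the coloops of `Q ∖ K` other than `w`, `w'`
  have hsub : coloops M (insert p.1 (insert p.2 (insert z B)) \ coloops M G) ⊆
      ((coloops M (insert z B \ coloops M G)).erase w).erase w' := by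
    intro u hu
    have hu' := hu
    rw [mem_coloops, hTeq] at hu'
    have hQsub : ∀ v, v ∉ insert z B →
        insert z B \ coloops M G ⊆ (insert p.1 (insert p.2 (insert z B \ coloops M G))).erase v := by
      intro v hv y hy
      exact Finset.mem_erase.2 ⟨fun hyv => hv (hyv ▸ (Finset.mem_sdiff.1 hy).1),
        Finset.mem_insert_of_mem (Finset.mem_insert_of_mem hy)⟩
    have hup1 : u ≠ p.1 := by
      rintro rfl
      exact hu'.2 (clF_mono (hQsub _ hp1.2) (hclQ _ hp1.1 hp1K))
    have hup2 : u ≠ p.2 := by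
      rintro rfl
      exact hu'.2 (clF_mono (hQsub _ hp2.2) (hclQ _ hp2.1 hp2K))
    have huQs : u ∈ insert z B \ coloops M G := by
      rcases Finset.mem_insert.1 hu'.1 with h' | h'
      · exact absurd h' hup1
      rcases Finset.mem_insert.1 h' with h'' | h''
      · exact absurd h'' hup2
      · exact h''
    have hucol : u ∈ coloops M (insert z B \ coloops M G) := by
      rw [mem_coloops]
      refine ⟨huQs, fun hc => hu'.2 (clF_mono ?_ hc)⟩
      exact Finset.erase_subset_erase _ ((Finset.subset_insert _ _).trans (Finset.subset_insert _ _))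
    have huw : u ≠ w := by
      rintro rfl
      exact hrest u hucol p.1 (Finset.mem_insert_self _ _) hp1.2 hp1F hu
    have huw' : u ≠ w' := by
      rintro rfl
      exact hrest u hucol p.2 (Finset.mem_insert_of_mem (Finset.mem_insert_self _ _)) hp2.2 hp2F' hu
    exact Finset.mem_erase.2 ⟨huw', Finset.mem_erase.2 ⟨huw, hucol⟩⟩
  calc (coloops M (insert p.1 (insert p.2 (insert z B)) \ coloops M G)).card
      ≤ (((coloops M (insert z B \ coloops M G)).erase w).erase w').card := Finset.card_le_card hsub
    _ = 1 := by
        rw [Finset.card_erase_of_mem (Finset.mem_erase.2 ⟨hww'.symm, hw'⟩), Finset.card_erase_of_mem hw, h3]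

/-- **A target of a nonzero `dshGT2` share has at most one coloop off `K`.** -/
theorem card_coloops_le_one_of_dshGT2_ne_zero (hG : G ∈ flatsQ M (5 + 1)) (hd : (gr M \ G).card = 2)
    (hk : kColoops M G = 1) (hs : ∀ e ∈ gr M, ∀ f ∈ gr M, e ≠ f → rkN M {e, f} = 2)
    (hl : ∀ e ∈ gr M, M.Indep {e}) {B : Finset α} (hB : B ∈ thinMembers M 5 G)
    (hbig : 5 ≤ (B \ coloops M G).card) {z : α} (hz : z ∈ G \ clF M B) {S : Finset α}
    (h : dshGT2 M 5 G B z S ≠ 0) : (coloops M (S \ coloops M G)).card ≤ 1 := by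
  have hloss : loss M 5 G B z ≠ 0 := fun h0 => h (dshGT2_eq_zero_of_loss_eq_zero h0 S)
  unfold dshGT2 at h
  split_ifs at h with h1 h2 h3 h4
  · exact card_coloops_le_one_of_mem_gtTargets hG hd hk hs hl hB hbig hz hloss h2
  · exact absurd rfl h
  · exact card_coloops_le_one_of_mem_d2Targets hG hd hk hs hl hB hbig hz hloss h4
  · exact absurd rfl h
  · exact absurd (d2Targets_nonempty_of_not_gtPts hG hd hk hs hl hB hbig hz hloss h1) h3

/-- The `dshGT2` load vanishes at a target with two or more coloops off `K`. -/
theorem dload_gt2_eq_zero_of_two_le_card_coloops (hG : G ∈ flatsQ M (5 + 1)) (hd : (gr M \ G).card = 2)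
    (hk : kColoops M G = 1) (hs : ∀ e ∈ gr M, ∀ f ∈ gr M, e ≠ f → rkN M {e, f} = 2)
    (hl : ∀ e ∈ gr M, M.Indep {e}) {S : Finset α} (h2 : 2 ≤ (coloops M (S \ coloops M G)).card) :
    dload M 5 G (bigP M G) (dshGT2 M 5 G) S = 0 := by
  unfold dload
  apply Finset.sum_eq_zero
  intro B hB
  apply Finset.sum_eq_zero
  intro z hz
  rw [Finset.mem_filter] at hB
  by_contra hne
  have := card_coloops_le_one_of_dshGT2_ne_zero hG hd hk hs hl hB.1 hB.2 hz hne
  omega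

/-- **The `dshGT2` column bound at targets with two or more coloops off `K`** (the load is zero). -/
theorem dload_gt2_le_cap2_of_two_le_card_coloops (hG : G ∈ flatsQ M (5 + 1)) (hd : (gr M \ G).card = 2)
    (hk : kColoops M G = 1) (hs : ∀ e ∈ gr M, ∀ f ∈ gr M, e ≠ f → rkN M {e, f} = 2)
    (hl : ∀ e ∈ gr M, M.Indep {e}) {S : Finset α} (hSG : S ⊆ G)
    (h2 : 2 ≤ (coloops M (S \ coloops M G)).card) :
    dload M 5 G (bigP M G) (dshGT2 M 5 G) S ≤ cap2 M 5 G S := by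
  rw [dload_gt2_eq_zero_of_two_le_card_coloops hG hd hk hs hl h2]
  exact cap2_nonneg (le_trans (by norm_num) (capS_ge_eleven_eighteenths_two_one hd hk hSG))

end PercRepro.Shadow
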